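import Summits.HubbardSuperconductivity.HubbardSuperconductivity.Theorems.AnisotropyChordTransferFibre3FinNamedSums
import Summits.HubbardSuperconductivity.HubbardSuperconductivity.Theorems.AnisotropyChordTransferFibre3FinConvCell

/-!
# Route `AnisotropyChord` / H0 rotor rung: FIN small-`L` EXACT-BLOCK evaluator of the row-`N₁` objects (computable, zero data)

The kernel evaluator of the FIN row-`N₁` certificate for `9 ≤ L ≤ 15` on one `λ·D`-cell `[la, lb]` (design: scratch mirror
`xb_mirror.py`; analytic kit `…Fibre3FinXBKit`; soundness `…Fibre3FinXBSound`).  Every momentum is a block momentum: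
* scalars on the cell (g4 `…FinGroundCell`: `csIv`, `dfnnIv = a`, `deltaIv`; here `XBScal`/`xbScal`: `λ, c_s, a, Δ, f_nn,
  d = a², q = a f_nn (2 − Δ), S₂, ‖s‖² = (c_s²S₂ + a²)/V, F₂(0) = V + 1 + ‖s‖² − (1 − a)², τ̄, γ = λF₂(0)/4 + a f_nn, ε₁`);
* per momentum: `T(k) = Σ_p g(p) g(p − k)` (`tTab`), `t(k) = (c_s²T(k) − 2a c_s g(k))/V`, `F₂(k) = −(2c_s g(k) + d) + t(k)`
  (`fAt`; `F₂(0)` from the scalars), `β(k) = c_s g(k) + d/2`;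
* per direction `e ∈ {x̂, −x̂, ŷ, −ŷ}` and momentum: the disc centre `m_e(k)` (`cenRe`, `cenIm`; `cos/sin (k·e)` from the
  cosine tables at modulus `L` and `4L`), its modulus bracket by integer square roots (`absIv`), `|φ̂_e(k)|²` (`n2Iv`) and the
  cross term `Re(conj φ̂_e(k) φ̂_e(k + x̂))` (`crossIv`), radius `τ̄/2`;
* objects `P = (1/V)ΣF₂³`, `A = (1/V)ΣF₂² cos kₓ`, `B = (6/V)ΣF₂²F₂(·+x̂)`, `Q = −(3/2V)Σ_eΣ_k|φ̂_e|²F₂`,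
  `B_C = −(3/V)Σ_e J_e` (`objP … objBC`);
* the certificate `xbCellOK L la lb cmin`: g4 `groundCellCheck`, `1 − Δ > 0`, `P⁻ > 0`, `0 ≤ cmin`, and
  `cmin · 3V²·(3λ⁺ + max(Q⁺/P⁻, Q⁺/P⁺)) ≤ N₁⁻` with `N₁⁻` the lower end of p1's `n1_ge_pieces` expression.
Prover seat `hubbard-h0-rotor-p3` g5; helper for piece A = stmt-HubbardSuperconductivity-23918 of rung 19089 (`--supports`, helper
class).  WHAT THIS IS NOT: nothing here proves superconductivity in the Hubbard model (rotor TARGET as worded stays FALSE, g15 verdict);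
evaluator infrastructure for the FIN certificates of ONE conditional reduction.  Tree imports only; no sorry, no new axioms.
-/

set_option linter.dupNamespace false
set_option autoImplicit false

namespace Summit.HubbardSuperconductivity.HubbardSuperconductivity.Theorems.AnisotropyChord.Transfer.Fibre3

namespace FinXB

open Hole2 FinCell

/-! ## Small interval helpers -/

/-- square with the non-negative clamp. [folklore] -/
def isqP (I : Iv) : Iv := (max (imul I I).1 0, (imul I I).2)

/-- `[max(lo,0), hi]`. [folklore] -/
def iclamp (I : Iv) : Iv := (max I.1 0, max I.2 0)

/-- enclosure of `√x` for `x ∈ I`, `x ≥ 0` (fixed point: `√(x)·D = √(x·D·D)`; floor / ceiling integer roots). [folklore] -/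
def isqrt (I : Iv) : Iv := ((Nat.sqrt ((max I.1 0).toNat * D.toNat) : ℤ), (Nat.sqrt ((max I.2 0).toNat * D.toNat) : ℤ) + 1)

/-- the symmetric interval `[−r⁺, r⁺]` of a radius enclosure. [folklore] -/
def ipm (r : Iv) : Iv := (-(max r.2 0), max r.2 0)

/-! ## Scalars on the cell -/

/-- the cell scalars (all fixed-point intervals). -/
structure XBScal where
  /-- `λ` -/
  lam : Iv
  /-- `c_s` -/
  cs : Iv
  /-- `a = Δ f_nn` -/
  a : Iv
  /-- `Δ` -/
  delta : Iv
  /-- `f_nn = Vλ/(4(1 − Δ))` -/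
  fnn : Iv
  /-- `d = a²` -/
  d : Iv
  /-- `q = a f_nn (2 − Δ)` -/
  q : Iv
  /-- `F₂(0) = V + 1 + ‖s‖² − (1 − a)²` -/
  nf2 : Iv
  /-- `τ̄` -/
  tauBar : Iv
  /-- `γ` -/
  gam : Iv
  /-- `ε₁ = 1 − cos(2π/L)` -/
  eps1 : Iv

/-- ★ the scalars of the cell `[la, lb]` from the cell reciprocal table `gt`. [folklore] -/
def xbScal (L : ℕ) (la lb : ℤ) (gt : List (List Iv)) : XBScal :=
  let V : ℕ := L * L
  let lam : Iv := (la, lb)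
  let cs := csIv L la lb
  let a := dfnnIv L la lb
  let delta := deltaIv L la lb
  let fnn := imul (iscale V lam) (iinv (iscale 4 (isub ione delta)))
  let d := imul a a
  let s2 := torSumIv L gt ![((0 : ℤ), (0 : ℤ))] ![2]
  let sn := idivn (iadd (imul (imul cs cs) s2) d) V
  let oma := isub ione a
  let nf2 := iadd (iconst ((V : ℤ) + 1)) (isub sn (imul oma oma))
  let eta := idivn (iscale V lam) 4
  let tauBar := iscale 2 (imul eta (iadd oma (idivn (isub (iadd ione sn) (imul oma oma)) V)))
  { lam := lam, cs := cs, a := a, delta := delta, fnn := fnn, d := d,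
    q := imul (imul a fnn) (isub (iconst 2) delta),
    nf2 := nf2, tauBar := tauBar,
    gam := iadd (idivn (imul lam nf2) 4) (imul a fnn),
    eps1 := isub ione (getIv (cosTab L) 1) }

/-- side conditions of the scalars: `1 − Δ > 0` (lower end) so that `f_nn` is a sound reciprocal. [folklore] -/
def xbScalOK (L : ℕ) (la lb : ℤ) : Bool :=
  decide (0 < (iscale 4 (isub ione (deltaIv L la lb))).1)

/-! ## Per-momentum values -/

/-- the two-propagator table `T(k) = Σ_p g(p) g(p − k)` at natural coordinates. [folklore] -/
def tTab (L : ℕ) (gt : List (List Iv)) : List (List Iv) :=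
  mkTab L fun k1 k2 =>
    psum (fun p1 => psum (fun p2 =>
      imul (gAt gt p1 p2) (gAt gt (modNat L ((p1 : ℤ) - k1)) (modNat L ((p2 : ℤ) - k2)))) L) L

/-- `t(k) = (c_s² T(k) − 2 a c_s g(k))/V` (`k ≠ 0`). [folklore] -/
def tAt (L : ℕ) (S : XBScal) (gt tt : List (List Iv)) (k1 k2 : ℕ) : Iv :=
  idivn (isub (imul (imul S.cs S.cs) (getF tt k1 k2)) (iscale 2 (imul (imul S.a S.cs) (gAt gt k1 k2)))) ((L : ℤ) * L)

/-- `F₂(k)`: `F₂(0)` from the scalars, else `−(2c_s g(k) + d) + t(k)`. [folklore] -/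
def fAt (L : ℕ) (S : XBScal) (gt tt : List (List Iv)) (k1 k2 : ℕ) : Iv :=
  if k1 = 0 ∧ k2 = 0 then S.nf2
  else iadd (ineg (iadd (iscale 2 (imul S.cs (gAt gt k1 k2))) S.d)) (tAt L S gt tt k1 k2)

/-- the `F₂` table. [folklore] -/
def fTabX (L : ℕ) (S : XBScal) (gt tt : List (List Iv)) : List (List Iv) := mkTab L fun k1 k2 => fAt L S gt tt k1 k2

/-- `β(k) = c_s g(k) + d/2`. [folklore] -/
def betaAt (S : XBScal) (gt : List (List Iv)) (k1 k2 : ℕ) : Iv := iadd (imul S.cs (gAt gt k1 k2)) (idivn S.d 2)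

/-! ## Per direction and momentum: the disc of `φ̂_e(k)` -/

/-- the phase index `k·e (mod L)` for the four directions `x̂, −x̂, ŷ, −ŷ` (`j = 0,1,2,3`). [folklore] -/
def phIdx (L : ℕ) (j k1 k2 : ℕ) : ℕ :=
  if j = 0 then k1 % L else if j = 1 then (k1 * (L - 1)) % L else if j = 2 then k2 % L else (k2 * (L - 1)) % L

/-- `cos(k·e)` from the cosine table at modulus `L`. [folklore] -/
def cosAt (L : ℕ) (ct : List Iv) (j k1 k2 : ℕ) : Iv := getIv ct (phIdx L j k1 k2)

/-- `sin(k·e) = cos(2π(4n + 3L)/(4L))` from the cosine table at modulus `4L`. [folklore] -/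
def sinAt (L : ℕ) (ct4 : List Iv) (j k1 k2 : ℕ) : Iv := getIv ct4 ((4 * phIdx L j k1 k2 + 3 * L) % (4 * L))

/-- `Re m_e(k) = (1 − cos)(t/2 − β) + (q/2)(1 + cos)` (`k ≠ 0`). [folklore] -/
def cenRe (L : ℕ) (S : XBScal) (gt tt : List (List Iv)) (ct : List Iv) (j k1 k2 : ℕ) : Iv :=
  iadd (imul (isub ione (cosAt L ct j k1 k2)) (isub (idivn (tAt L S gt tt k1 k2) 2) (betaAt S gt k1 k2)))
    (imul (idivn S.q 2) (iadd ione (cosAt L ct j k1 k2)))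

/-- `Im m_e(k) = sin·(t/2 − β − q/2)` (`k ≠ 0`). [folklore] -/
def cenIm (L : ℕ) (S : XBScal) (gt tt : List (List Iv)) (ct4 : List Iv) (j k1 k2 : ℕ) : Iv :=
  imul (sinAt L ct4 j k1 k2) (isub (isub (idivn (tAt L S gt tt k1 k2) 2) (betaAt S gt k1 k2)) (idivn S.q 2))

/-- the disc of `φ̂_e(k)` as `(Re-centre, Im-centre, radius)`; at `k = 0` the exact real value `γ` with radius `0`. [folklore] -/
def disc (L : ℕ) (S : XBScal) (gt tt : List (List Iv)) (ct ct4 : List Iv) (j k1 k2 : ℕ) : Iv × Iv × Iv :=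
  if k1 = 0 ∧ k2 = 0 then (S.gam, (0, 0), (0, 0))
  else (cenRe L S gt tt ct j k1 k2, cenIm L S gt tt ct4 j k1 k2, idivn S.tauBar 2)

/-- the modulus bracket `‖m‖ ∈ absIv` from the parts. [folklore] -/
def absIv (re im : Iv) : Iv := isqrt (iadd (isqP re) (isqP im))

/-- `|φ̂_e(k)|² ∈ [max(‖m‖ − r, 0)², (‖m‖ + r)²]`. [folklore] -/
def n2Of (dsc : Iv × Iv × Iv) : Iv :=
  let ab := absIv dsc.1 dsc.2.1
  let w := iclamp (iadd ab (ipm dsc.2.2))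
  (max (imul (w.1, w.1) (w.1, w.1)).1 0, (imul (w.2, w.2) (w.2, w.2)).2)

/-- `Re(conj φ̂ φ̂′) ∈ (Re m Re m′ + Im m Im m′) ± (‖m‖r′ + ‖m′‖r + r r′)`. [folklore] -/
def crossOf (d1 d2 : Iv × Iv × Iv) : Iv :=
  let base := iadd (imul d1.1 d2.1) (imul d1.2.1 d2.2.1)
  let a1 := absIv d1.1 d1.2.1
  let a2 := absIv d2.1 d2.2.1
  let dev := iadd (iadd (imul a1 (ipm d2.2.2)) (imul a2 (ipm d1.2.2))) (imul (ipm d1.2.2) (ipm d2.2.2))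
  iadd base (-(max dev.2 0), max dev.2 0)

/-! ## Objects -/

/-- `Σ_k F₂(k)³` (table `ft`). [folklore] -/
def sumF3 (L : ℕ) (ft : List (List Iv)) : Iv :=
  psum (fun k1 => psum (fun k2 => imul (imul (getF ft k1 k2) (getF ft k1 k2)) (getF ft k1 k2)) L) L

/-- `Σ_k F₂(k)² cos kₓ`. [folklore] -/
def sumF2cos (L : ℕ) (ft : List (List Iv)) (ct : List Iv) : Iv :=
  psum (fun k1 => psum (fun k2 => imul (imul (getF ft k1 k2) (getF ft k1 k2)) (getIv ct (k1 % L))) L) L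

/-- `Σ_k F₂(k)² F₂(k + x̂)`. [folklore] -/
def sumF2Fx (L : ℕ) (ft : List (List Iv)) : Iv :=
  psum (fun k1 => psum (fun k2 => imul (imul (getF ft k1 k2) (getF ft k1 k2)) (getF ft ((k1 + 1) % L) k2)) L) L

/-- `Σ_e Σ_k |φ̂_e(k)|² F₂(k)` (four directions). [folklore] -/
def sumN2F (L : ℕ) (S : XBScal) (gt tt ft : List (List Iv)) (ct ct4 : List Iv) : Iv :=
  psum (fun j => psum (fun k1 => psum (fun k2 =>
    imul (n2Of (disc L S gt tt ct ct4 j k1 k2)) (getF ft k1 k2)) L) L) 4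

/-- `Σ_e J_e`, `J_e = Σ_k [Re(conj φ̂_e(k) φ̂_e(k+x̂))(F₂(k) + F₂(k+x̂)) + |φ̂_e(k)|² F₂(k+x̂)]`. [folklore] -/
def sumJ (L : ℕ) (S : XBScal) (gt tt ft : List (List Iv)) (ct ct4 : List Iv) : Iv :=
  psum (fun j => psum (fun k1 => psum (fun k2 =>
    let d1 := disc L S gt tt ct ct4 j k1 k2
    let d2 := disc L S gt tt ct ct4 j ((k1 + 1) % L) k2
    iadd (imul (crossOf d1 d2) (iadd (getF ft k1 k2) (getF ft ((k1 + 1) % L) k2)))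
      (imul (n2Of d1) (getF ft ((k1 + 1) % L) k2))) L) L) 4

/-- the five object brackets `(B, P, A, Q, B_C)` of the cell. [folklore] -/
structure XBObj where
  /-- `B = (6/V) Σ F₂² F₂(·+x̂)` -/
  B : Iv
  /-- `P = ‖Π⁰‖² = (1/V) Σ F₂³` -/
  P : Iv
  /-- `A(x̂) = (1/V) Σ F₂² cos kₓ` -/
  A : Iv
  /-- `Q = ⟨Π⁰, C0⟩ = −(3/2V) Σ_e Σ_k |φ̂_e|² F₂` -/
  Q : Iv
  /-- `B_C = −(3/V) Σ_e J_e` -/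
  C : Iv

/-- ★ the objects of the cell. [folklore] -/
def xbObj (L : ℕ) (S : XBScal) (gt tt : List (List Iv)) (ct ct4 : List Iv) : XBObj :=
  let V : ℤ := (L : ℤ) * L
  let ft := fTabX L S gt tt
  { B := idivn (iscale 6 (sumF2Fx L ft)) V,
    P := idivn (sumF3 L ft) V,
    A := idivn (sumF2cos L ft ct) V,
    Q := ineg (idivn (iscale 3 (sumN2F L S gt tt ft ct ct4)) (2 * V)),
    C := ineg (idivn (iscale 3 (sumJ L S gt tt ft ct ct4)) V) }

/-! ## The certificate -/

/-- an exact endpoint as a degenerate interval. [folklore] -/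
def ipt (z : ℤ) : Iv := (z, z)

/-- one corner `−(Q·B/P)` at endpoint values (lower end used). [folklore] -/
def corner (q b p : ℤ) : ℤ := (ineg (imul (imul (ipt q) (ipt b)) (iinv (ipt p)))).1

/-- the minimum of the eight corners. [folklore] -/
def minCorner (O : XBObj) : ℤ :=
  min (min (min (corner O.Q.1 O.B.1 O.P.1) (corner O.Q.1 O.B.1 O.P.2)) (min (corner O.Q.1 O.B.2 O.P.1) (corner O.Q.1 O.B.2 O.P.2)))
      (min (min (corner O.Q.2 O.B.1 O.P.1) (corner O.Q.2 O.B.1 O.P.2)) (min (corner O.Q.2 O.B.2 O.P.1) (corner O.Q.2 O.B.2 O.P.2)))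

/-- ★ `N₁⁻`: the lower end of `−ε₁B⁺ + min corners − (ε₁/2)(3λP⁺ + Q⁺ + 12 a f_nn A⁺) + B_C⁻` in fixed point. [folklore] -/
def n1Lo (S : XBScal) (O : XBObj) : ℤ :=
  (imul (ineg S.eps1) (ipt O.B.2)).1 + minCorner O
    + (ineg (imul (idivn S.eps1 2)
        (iadd (iadd (iscale 3 (imul S.lam (ipt O.P.2))) (ipt O.Q.2)) (iscale 12 (imul (imul S.a S.fnn) (ipt O.A.2)))))).1
    + O.C.1

/-- ★ `T⁺⁺·D`: the upper end of `3λ + max(Q⁺/P⁻, Q⁺/P⁺)` in fixed point. [folklore] -/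
def tPlusHi (S : XBScal) (O : XBObj) : ℤ :=
  (iscale 3 S.lam).2 + max (imul (ipt O.Q.2) (iinv (ipt O.P.1))).2 (imul (ipt O.Q.2) (iinv (ipt O.P.2))).2

/-- everything of the cell from the tables (scalars, objects). [folklore] -/
def xbEval (L : ℕ) (la lb : ℤ) : XBScal × XBObj :=
  let gt := gresCellTab L (cosTab L) la lb
  let S := xbScal L la lb gt
  let tt := tTab L gt
  (S, xbObj L S gt tt (cosTab L) (cosTab (4 * L)))

/-- ★ THE CELL CERTIFICATE of the row-`N₁` crux at this `L` on the `λ·D`-cell `[la, lb]` with constant `cmin`: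
ground-cell check, `1 − Δ > 0`, `P⁻ > 0`, `0 ≤ cmin`, and `cmin·3V²·T⁺⁺ ≤ N₁⁻`. [folklore] -/
def xbCellOK (L : ℕ) (la lb : ℤ) (cmin : ℚ) : Bool :=
  let E := xbEval L la lb
  groundCellCheck L la lb && xbScalOK L la lb && decide (0 < E.2.P.1) && decide (0 ≤ cmin) &&
    decide (cmin * (((3 * ((L : ℤ) * L) ^ 2 * tPlusHi E.1 E.2 : ℤ)) : ℚ) ≤ ((n1Lo E.1 E.2 : ℤ) : ℚ))

end FinXB

end Summit.HubbardSuperconductivity.HubbardSuperconductivity.Theorems.AnisotropyChord.Transfer.Fibre3
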